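import Mathlib
import HarnessLib
import Summits.ValiantsHypothesis.ValiantsHypothesis.Theses.MonotoneRestoration
import Literature.Computability.AlgebraicComplexity.ArithCircuit
import Literature.Computability.AlgebraicComplexity.ArithCircuitProofs
import Literature.Computability.AlgebraicComplexity.MonotoneStructure
import Literature.Computability.AlgebraicComplexity.PermanentIrreducible
import Literature.ModelTheory.FiniteModelTheory.CkEquiv
import Summits.ValiantsHypothesis.ValiantsHypothesis.Theorems.MonotoneRestorationMonotoneRestorationQPCosetCount
import Summits.ValiantsHypothesis.ValiantsHypothesis.Theorems.MonotoneRestorationMonotoneRestorationQPSymmetricLB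
import Summits.ValiantsHypothesis.ValiantsHypothesis.Theorems.MonotoneRestorationMonotoneRestorationQPSupportSymmetrisation
import Summits.ValiantsHypothesis.ValiantsHypothesis.Theorems.MonotoneRestorationMonotoneRestorationQPSparseRegime
import Summits.ValiantsHypothesis.ValiantsHypothesis.Theorems.MonotoneRestorationMonotoneRestorationQPBeta
import Literature.Computability.AlgebraicComplexity.SymmetricArithCircuit
import Literature.Computability.AlgebraicComplexity.DawarWilsenach2025Proofs
import Literature.GroupTheory.PermutationGroups.SmallIndexSubgroups
import Summits.ValiantsHypothesis.ValiantsHypothesis.Theorems.MonotoneRestorationQP.Negative.LoadBearing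
import Summits.ValiantsHypothesis.ValiantsHypothesis.Theorems.MonotoneRestorationMonotoneRestorationQPPermSupportCount

/-! TTRL-lite variant V19135 of stmt-ValiantsHypothesis-15886 -/

-- `Summit.ValiantsHypothesis.ValiantsHypothesis.…` is the tree's mandated single-conjunct layout
-- (Sub = Summit), so the duplicated namespace component is intended.
set_option linter.dupNamespace false

namespace Summit.ValiantsHypothesis.ValiantsHypothesis.Theorems

open Summit.ValiantsHypothesis.ValiantsHypothesis.Theses.MonotoneRestoration
open Literature.Computability.AlgebraicComplexity

/-- **TTRL-lite variant V19135** (`lemma_proposal`) of `stub_esymmRowSums_structure`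
(crux item `stmt-ValiantsHypothesis-15886`): the general principle behind the homogeneity
conjunct — substituting polynomials `g i`, each homogeneous of degree `1`, into the elementary
symmetric polynomial `e_k` yields a polynomial homogeneous of degree `k`.  Proof: expand
`bind₁ g (e_k) = Σ_{|t| = k} ∏_{i ∈ t} g i` and use `IsHomogeneous.sum` / `IsHomogeneous.prod`
(`Σ_{i ∈ t} 1 = |t| = k`).  The row sums `R_i = Σ_j x_{i,j}` are the case `g i = R_i`.
[folklore] -/
theorem stub_esymmRowSums_structure_var19135 :
    ∀ (n k : ℕ) (g : Fin n → MvPolynomial (Fin n × Fin n) NNReal),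
      (∀ i : Fin n, (g i).IsHomogeneous 1) →
        (MvPolynomial.bind₁ g (MvPolynomial.esymm (Fin n) NNReal k)).IsHomogeneous k := by
  intro n k g hg
  simp only [MvPolynomial.esymm, map_sum, map_prod, MvPolynomial.bind₁_X_right]
  refine MvPolynomial.IsHomogeneous.sum _ _ _ fun t ht => ?_
  have hcard : ∑ i ∈ t, (1 : ℕ) = k := by
    rw [Finset.sum_const, smul_eq_mul, mul_one]
    exact (Finset.mem_powersetCard.1 ht).2
  rw [← hcard]
  exact MvPolynomial.IsHomogeneous.prod t _ (fun _ => 1) fun i _ => hg i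

end Summit.ValiantsHypothesis.ValiantsHypothesis.Theorems
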